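import Summits.CriticalPhenomena.PercolationContinuityZ3.Theorems.PercNearOneGluingNoHeavyLowerTailSunflowerMultiPetalKempeMarkedHeart
import Summits.CriticalPhenomena.PercolationContinuityZ3.Theorems.PercNearOneGluingNoHeavyLowerTailSunflowerMultiPetalKempeMarkedContract
import HarnessLib
import HarnessLib.Audit

/-!
# `NoHeavyLowerTail` (crux stmt-CriticalPhenomena-4575), marked-multigraph layer: **THEOREM L1 — THE NEIGHBOURHOOD-CONTRACTION STEP LAW —
# KERNEL-CHECKED** (|S| ≥ 2 and |S| = 0)

Support file (seat `prim-l12-p2` gen 47; `--supports stmt-CriticalPhenomena-4575`; continuation of `…KempeMarkedHeart` (p596349: `sum_resCell_nonneg`) and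
`…KempeMarkedContract` (`TfunM_peelContract`)).  No `sorry`; nothing is asserted about the crux.
Memo: run/shared/lean/prim/prim-l12/prim-l12-p2/FINDING-g47-NEIGHBOURHOOD-CONTRACTION-STEP.md §2–§4, PROOF-LEMMA-B-MARKED-MULTIGRAPHS-g47.md §2.

For a marked multigraph `K` on `V`, terminals `u ≠ v`, an UNMARKED non-terminal `y` with `K.mul y u ≠ 0` and `S = {w ∉ {u,v,y} : K.mul y w ≠ 0}`:
* **`TfunM_step`** (`|S| ≥ 2`):  `3^{|S|}·TfunM (K.isolate y) u v + TfunM (K.peelContract y S u) u v ≤ 3^{|S|+1}·TfunM K u v` —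
  since `K.isolate y` carries one and `K.peelContract y S u` carries `|S|+1` isolated unmarked vertices (each a factor `3`), this is exactly
  `T(K − y; u,v) + T((K − y)/(S ∪ {u} → u); u,v) ≤ T(K; u,v)`, the step law of the memo, now a kernel-checked theorem for every degree ≥ 2 + 1;
* **`TfunM_step_zero`** (`S = ∅`, `y` adjacent only to terminals):  `2·TfunM (K.isolate y) u v ≤ 3·TfunM K u v`, i.e. `2·T(K−y) ≤ T(K)`
  (the finite core `pendant_pair_nonneg` of p593133 transported by the swap `Φ_u` on the colourings of `K − y`).
The case `|S| = 1` (a separate small pairing) and the Lemma-B induction (memo §4: with `TfunM_isolate_le_of_mark` p595201, `TfunM_nonneg_of_mark` p595260,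
and THEOREM R for marked multigraphs) are the remaining formalization targets.
-/

namespace Summit.CriticalPhenomena.PercolationContinuityZ3.Theorems.SunflowerPartition.Kempe

open Finset

namespace MGraph

variable {V : Type*} [Fintype V] [LinearOrder V] (K : MGraph V)

/-! ## The step law: assembly (|S| ≥ 2) and the degree-0 case -/

section Step

/-- **THEOREM L1 — THE NEIGHBOURHOOD-CONTRACTION STEP LAW, kernel-checked for `|S| ≥ 2`** (memo FINDING-g47 §2; same-vertex-type form): for terminals
`u ≠ v`, an UNMARKED non-terminal `y` with `mul y u ≠ 0`, and `S = N(y) ∖ {u,v}` with `|S| ≥ 2`,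
`3^{|S|}·T(K.isolate y) + T(K.peelContract y S u) ≤ 3^{|S|+1}·T(K)`, i.e. `T(K−y) + T((K−y)/(S∪u → u)) ≤ T(K)` after removing the factors `3`
contributed by the isolated vertices. [this work] -/
theorem TfunM_step (u v y : V) (huv : u ≠ v) (hyu : y ≠ u) (hyv : y ≠ v) (hmark : K.mark y = 0) (hadj : K.mul y u ≠ 0)
    (S : Finset V) (hS : ∀ w, w ∈ S ↔ (w ≠ u ∧ w ≠ v ∧ w ≠ y ∧ K.mul y w ≠ 0)) (htwo : 2 ≤ S.card) :
    3 ^ S.card * (K.isolate y).TfunM u v + (K.peelContract y S u).TfunM u v ≤ 3 ^ (S.card + 1) * K.TfunM u v := by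
  have huS : u ∉ S := fun h => ((hS u).1 h).1 rfl
  have hvS : v ∉ S := fun h => ((hS v).1 h).2.1 rfl
  have hyS : y ∉ S := fun h => ((hS y).1 h).2.2.1 rfl
  let u' : ({y}ᶜ : Set V) := ⟨u, Set.mem_compl_singleton_iff.mpr hyu.symm⟩
  let v' : ({y}ᶜ : Set V) := ⟨v, Set.mem_compl_singleton_iff.mpr hyv.symm⟩
  have h1 := K.sum_resCell_eq y S u' v'
  have h2 := sum_resCell_nonneg (K := K) hS huv hyu hyv hmark hadj htwo
  have hB := K.TfunM_peelContract y u v S hyu.symm huS hyS hvS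
  dsimp only [u', v'] at h1
  rw [h1] at h2
  rw [hB, pow_succ]
  have hp : (0 : ℤ) ≤ 3 ^ S.card := by positivity
  have key : (K.isolate y).TfunM u v + K.allZeroSum y S u v ≤ 3 * K.TfunM u v := by linarith
  nlinarith [mul_le_mul_of_nonneg_left key hp]

/-- With no outer neighbours, the all-0 sum over `S = ∅` is `T(K.isolate y)` itself. [this work] -/
theorem allZeroSum_empty (y u v : V) : K.allZeroSum y ∅ u v = (K.isolate y).TfunM u v := by
  unfold allZeroSum TfunM
  refine sum_congr rfl fun ρ _ => ?_
  rw [if_pos (fun s hs => absurd hs (notMem_empty s))]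

/-- **THE DEGREE-0 CASE** (a `y` adjacent only to terminals, unmarked, `y ∼ u`): `2·T(K.isolate y) ≤ 3·T(K)`, i.e. `2·T(K−y) ≤ T(K)`
(memo §2, d = 0; the finite core is `pendant_pair_nonneg` of p593133, transported by the swap `Φ_u` on the colourings of `K − y`). [this work] -/
theorem TfunM_step_zero (u v y : V) (huv : u ≠ v) (hyu : y ≠ u) (hyv : y ≠ v) (hmark : K.mark y = 0) (hadj : K.mul y u ≠ 0)
    (hnone : ∀ w, w ≠ u → w ≠ v → K.mul y w = 0) :
    2 * (K.isolate y).TfunM u v ≤ 3 * K.TfunM u v := by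
  let u' : ({y}ᶜ : Set V) := ⟨u, Set.mem_compl_singleton_iff.mpr hyu.symm⟩
  let v' : ({y}ᶜ : Set V) := ⟨v, Set.mem_compl_singleton_iff.mpr hyv.symm⟩
  have h1 := K.sum_resCell_eq y ∅ u' v'
  dsimp only [u', v'] at h1
  rw [allZeroSum_empty] at h1
  -- the residual with S = ∅ and its pairing under Φ_u
  set F := univ.filter (fun ρ : V → Fin 3 => ρ u = 0 ∧ ρ v = 1) with hF
  have memF : ∀ ρ, ρ ∈ F ↔ ρ u = 0 ∧ ρ v = 1 := fun ρ => by rw [hF, mem_filter]; simp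
  have hres : ∀ ρ : V → Fin 3, K.resCell y ∅ ρ = kerTAbs ((K.isolate y).ctypeM ρ) (K.profM y ρ) - fC ((K.isolate y).ctypeM ρ) := by
    intro ρ; unfold resCell; rw [if_pos (fun s hs => absurd hs (notMem_empty s))]
  -- the profile of y: (cap (mul y u), cap (mul y v), 0) for every terminal-coloured colouring, also after the swap
  have hprof : ∀ ρ : V → Fin 3, ρ u = 0 → ρ v = 1 → K.profM y ρ = (cap3 (K.mul y u), cap3 (K.mul y v), 0) := by
    intro ρ hu hv
    have hl : ∀ c, K.linkM y ρ c = (if (0 : Fin 3) = c then K.mul y u else 0) + (if (1 : Fin 3) = c then K.mul y v else 0) := by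
      intro c
      unfold linkM
      rw [← Finset.sum_erase_add _ _ (mem_univ u), ← Finset.sum_erase_add _ _ (mem_erase.2 ⟨huv.symm, mem_univ v⟩), hu, hv]
      have hz : ∑ w ∈ (univ.erase u).erase v, (if ρ w = c then K.mul y w else 0) = 0 :=
        sum_eq_zero fun w hw => by
          have hwv : w ≠ v := (mem_erase.1 hw).1
          have hwu : w ≠ u := (mem_erase.1 (mem_erase.1 hw).2).1
          rw [hnone w hwu hwv]; simp
      rw [hz, zero_add, add_comm]
    unfold profM
    rw [hl 0, hl 1, hl 2, hmark]
    simp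
    rfl
  have hpair : ∀ ρ ∈ F, 0 ≤ K.resCell y ∅ ρ + K.resCell y ∅ (phiU u ρ) := by
    intro ρ hρ
    obtain ⟨hu, hv⟩ := (memF ρ).1 hρ
    have hφu : phiU u ρ u = 0 := by rw [phiU_self, hu]
    have hφv : phiU u ρ v = 1 := by rw [phiU_of_ne u ρ huv.symm, hv]; decide
    rw [hres, hres, hprof ρ hu hv, hprof (phiU u ρ) hφu hφv]
    -- types before/after the swap in K' = K.isolate y
    have e1 := (K.isolate y).cntM_phiU_one u ρ hu
    have e2 := (K.isolate y).cntM_phiU_two u ρ hu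
    have e0 := (K.isolate y).cntM_phiU_zero u ρ hu
    have d0 := (K.isolate y).cntM_eq_isolate_add u ρ 0
    rw [hu] at d0; simp only [if_true] at d0
    have hk0 : cap3 (K.mul y u) ≠ 0 := fun h => hadj ((eq_zero_iff_cap3 _).2 h)
    have ht : (K.isolate y).ctypeM ρ = (capAdd (cap3 ((K.isolate y).cntM (phiU u ρ) 2)) (cap3 ((K.isolate y).linkM u ρ 0 + (K.isolate y).mark u)),
        cap3 ((K.isolate y).cntM ρ 1), cap3 ((K.isolate y).cntM ρ 2)) := by
      unfold ctypeM
      refine Prod.ext ?_ (Prod.ext rfl rfl)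
      simp only
      rw [← cap3_add]; congr 1; omega
    have ht' : (K.isolate y).ctypeM (phiU u ρ) = (capAdd (cap3 ((K.isolate y).cntM ρ 2)) (cap3 ((K.isolate y).linkM u ρ 2 + (K.isolate y).mark u)),
        cap3 ((K.isolate y).cntM ρ 1), cap3 ((K.isolate y).cntM (phiU u ρ) 2)) := by
      unfold ctypeM
      refine Prod.ext ?_ (Prod.ext ?_ rfl)
      · simp only; rw [← cap3_add, e0]
      · simp only; rw [e1]
    rw [ht, ht']
    exact pendant_pair_nonneg _ _ _ _ _ _ _ hk0
  -- Σ_F res = Σ_F res ∘ Φ_u (Φ_u is an involution of F), hence 2 Σ_F res ≥ 0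
  have hperm : ∑ ρ ∈ F, K.resCell y ∅ (phiU u ρ) = ∑ ρ ∈ F, K.resCell y ∅ ρ := by
    refine sum_nbij' (phiU u) (phiU u) (fun ρ hρ => ?_) (fun ρ hρ => ?_) (fun ρ _ => phiU_phiU u ρ) (fun ρ _ => phiU_phiU u ρ) (fun ρ _ => rfl)
    · obtain ⟨hu, hv⟩ := (memF ρ).1 hρ
      exact (memF _).2 ⟨by rw [phiU_self, hu], by rw [phiU_of_ne u ρ huv.symm, hv]; decide⟩
    · obtain ⟨hu, hv⟩ := (memF ρ).1 hρ
      exact (memF _).2 ⟨by rw [phiU_self, hu], by rw [phiU_of_ne u ρ huv.symm, hv]; decide⟩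
  have h2 : 0 ≤ 2 * ∑ ρ ∈ F, K.resCell y ∅ ρ := by
    have hsum : ∑ ρ ∈ F, K.resCell y ∅ ρ + ∑ ρ ∈ F, K.resCell y ∅ ρ = ∑ ρ ∈ F, (K.resCell y ∅ ρ + K.resCell y ∅ (phiU u ρ)) := by
      rw [sum_add_distrib, hperm]
    rw [two_mul, hsum]
    exact sum_nonneg fun ρ hρ => hpair ρ hρ
  rw [h1] at h2
  linarith

end Step

end MGraph

end Summit.CriticalPhenomena.PercolationContinuityZ3.Theorems.SunflowerPartition.Kempe
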